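import Mathlib
import HarnessLib
import HarnessLib.Audit
import Summits.PneNP.Statement
import Literature.Computability.Complexity.Unambiguous
import Literature.Computability.Complexity.CNF
import Literature.Computability.Complexity.CookBridges
import Literature.Computability.Complexity.NegCNFTranscoder
import Literature.Computability.QuantumComplexity.FactoringUP
import HarnessLib.Audit.Status.Attr

/-!
Route: NtimeNotUnambiguousLadder

CLOSED (closed) 2026-08-27T13:17:55Z by operator:999:1000014 — reason: tribunal-failed:summit-strength — note: T1 11:50Z/J 12:10Z FAIL; owner repair-1: no two load-bearing pieces for rung NlinNotInUlin 19826 this gen; 19826 -> F-N1 open seed (HR97 s1 named-open) (director-frontier g9 13:05:30Z). The file is kept as the record of this route; refuted decls are indexed as negative knowledge (`ledger negatives`).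

# Route NtimeNotUnambiguousLadder — nondeterministic linear time is not unambiguous linear time —
rung 1 of the NTIME(n) ⊄ UTIME(n^c) ladder

It suffices to show X = X1 ∧ R. X1 (`NlinNotInUlin`, the ATTACKED crux): multi-stack (Mathlib `TM2`)
nondeterministic linear time is not
unambiguous linear time, `NTIME(n) ⊄ UTIME(n)` — rung c = 1 of the unambiguous ladder `ULadder` :
`NTIME(n) ⊄ UTIME(n^c)` for every
c ≥ 1 (the target). R (`LadderClimbU`, DECLARED RESIDUAL, summit-strength-plus: dominated by the
unregistered top NP ≠ UP): rung 1 climbs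
the whole ladder. The provable support S1 (`UCalibration`) turns the ladder into "SAT has no
unambiguous verifier of any polynomial budget",
whence `SAT ∉ UP ⊇ P`, `P ≠ NP`, Cook's shape `PneNP`. `UTIME` is the verifier-side twin of `NTIME`
landed for this route
(`Literature/Computability/Complexity/Unambiguous.lean`, p171867: `UTIME`, `coUTIME`, `UP = ⋃ₖ
UTIME(nᵏ)`). Types the mwave sketch
ntime-not-unambiguous-ladder (readers PASS/high; no idea card of that slug exists, hence `ideas:
[]`) — the hub's first carrier of the UNAMBIGUOUS column of the 1983 PPST template.
Lean: `¬ (Literature.Computability.Complexity.NTIME (fun n : ℕ => n) ⊆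
Literature.Computability.Complexity.UTIME (fun n : ℕ => n)) ∧ (¬
(Literature.Computability.Complexity.NTIME (fun n : ℕ => n) ⊆
Literature.Computability.Complexity.UTIME (fun n : ℕ => n)) → ∀ c : ℕ, 1 ≤ c → ¬
(Literature.Computability.Complexity.NTIME (fun n : ℕ => n) ⊆
Literature.Computability.Complexity.UTIME (fun n : ℕ => n ^ c)))`

## Assembly
Pure logic plus four tree theorems (sorry-free `closes` in glue.lean / Sketch.lean, `lean check` rc
0): from h₁ : NlinNotInUlin and
h₂ : LadderClimbU get ULadder; h₃ : UCalibration gives ∀ k, SAT ∉ UTIME(n^k), i.e. SAT ∉ ⋃ₖ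
UTIME(nᵏ) = UP (`UP_eq_iUnion_UTIME`); if
Classes.P = Nondeterministic.NP then SAT ∈ P (`SAT_mem_NP_holds`) ⊆ UP (`P_subset_UP`),
contradiction; hence P ≠ NP over the tree's
classes and `pneNP_shape_of_P_ne_NP` gives `PneNP`. `closes` is the deciding theorem and
consumes all three binders (cone: 2 open cruxes + 1 support); the Assembly item below is that
implication as a Prop, proved inside `closes`.

Rationale: WHY THIS LINE. Paul–Pippenger–Szemerédi–Trotter (PaulEtAl1983) separated NTIME(n) from DTIME(n) for
multitape machines by a tape-structure argument that
does not relativize; the same template has three right-hand columns — deterministic (done, 1983),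
co-nondeterministic (Book–Greibach,
open; the retired sibling NtimeComplementLadder) and UNAMBIGUOUS (Valiant1976's UP one level down:
HemaspaandraRothe1997 §1 lists
NTIME vs UTIME at linear time as open; nothing in either corpus treats it). The imported lever is
communication-complexity's partition-
versus-cover gap (unambiguous acceptors induce rectangle PARTITIONS of the crossing matrix along a
padding block, nondeterministic ones only
COVERS; Yannakakis1991, Jukna2012 ch. 3–4) transferred to machines by crossing sequences: it already
proves the single-tape analogue
1-NTIME(n) ⊄ 1-UTIME(o(n²)) (ported sorry-free in the seat folder,
`NtuLower.unambiguous_lower_bound`) and the sublinear-space truncation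
for the explicit witness Collision = "two blocks of the input coincide" (∈ NTIME(n), conjecturally ∉
UTIME(n)). What the line does that
no PneNP route or negative does: it puts a machine-class separation with a PROVED lever and an
explicit P-witness language on the ledger;
its honest limit is the residual R (every climb from a fixed exponent to all exponents is the top NP
≠ UP in disguise).

RANKED CRUXES. #0 ULadder (target) — the unambiguous ladder — for every c ≥ 1, NTIME(n) ⊄ UTIME(n^c)
(multi-stack TM2 verifier classes); rung 1 is NlinNotInUlin up to `pow_one`. (why it might fail:
equivalent (padding up, uniform Cook–Levin down) to NP ≠ UP, a super-summit top: refuted by any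
collapse NTIME(n) ⊆ UTIME(n^c), e.g. from an isolation lemma derandomised at polynomial cost.)
[Valiant1976, HemaspaandraRothe1997, Book1974]
#2 NlinNotInUlin (crux) — nondeterministic linear time (TM2 verifiers with linear clock and linear
witness) is not contained in unambiguous linear time: ¬ (NTIME(n) ⊆ UTIME(n)). Sketch item X1; doors
L1 (Collision ∉ UTIME(n), birth skeleton) and L2 (U-complementation + the sibling's coNTIME(n) ⊄
NTIME(n)). [difficulty: open-problem] (why it might fail: multi-stack NLIN ⊆ ULIN contradicts
nothing known: every proved U ≠ N time separation is single-tape, finite-automaton or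
protocol-level, or needs advice; an isolation-style unambiguous simulation at linear cost (cf. NL ⊆
UL/poly) would refute it.) [HemaspaandraRothe1997, PaulEtAl1983, BookGreibachWegbreit1970,
book:editor1996-automata-languages-programming, Yannakakis1991]
#3 LadderClimbU (crux) — DECLARED RESIDUAL — rung 1 climbs the ladder: NTIME(n) ⊄ UTIME(n) → ∀ c ≥
1, NTIME(n) ⊄ UTIME(n^c). Equivalent, given rung 1, to NP ≠ UP; implied by the downward translation
"NP = UP ⇒ NTIME(n) ⊆ UTIME(n)"; dominated by the (unregistered) top NP ≠ UP through unambiguous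
upward padding (folklore, unprinted as far as searched). Not attacked; carried so that `closes` is
honest about what separates rung 1 from P ≠ NP. [deps: NlinNotInUlin] [difficulty: open-problem]
(why it might fail: false iff NLIN ⊄ ULIN yet NLIN ⊆ UTIME(n^c) for some c ≥ 2 — a priori consistent
(no downward translation NP = UP ⇒ NLIN ⊆ ULIN is known; HIS85-type translations go upward only, and
relativized worlds separate the two levels).) [Book1974, HartmanisImmermanSewelson1985,
HemaspaandraRothe1997]
#9 UCalibration (support) — calibration, provable (L): the ladder denies SAT an unambiguous verifier
of every polynomial budget — ULadder → ∀ k, SAT ∉ UTIME(n^k). Proof plan: SAT ∈ UTIME(n^k) + a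
UNIFORM Cook–Levin exponent a for NTIME(n) (every L ∈ NTIME(n) Karp-reduces to SAT in deterministic
time O(n^a), tree `CookLevinTableau`) + pull-back closure of UTIME under such reductions ⇒ NTIME(n)
⊆ UTIME(n^{ak+a}), contradicting the rung c = ak + a. [difficulty: L] [AroraBarakCC2009, Cook1971,
Valiant1976]

TWO-LAYER PLAN. Foreseen glued splits (birth skeletons exist in the seat folder, to be published
under Cruxes/ after open; nothing filed now):
NlinNotInUlin ⇐ CollisionMemNlin → CollisionNotInUlin → NlinNotInUlin (door L1: Collision = {w :
some two length-prefixed blocks of w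
coincide}, typed with `decodeBlocks`; the second child is the real content); NlinNotInUlin ⇐
ConlinNotInNlin → ComplU → NlinNotInUlin
(door L2: the retired sibling's rung ¬(coNTIME(n) ⊆ NTIME(n)) plus "NTIME(n) ⊆ UTIME(n) ⇒ coUTIME(n)
⊆ NTIME(n)"); LadderClimbU ⇐
PadCollapseU (∀ c ≥ 1, NTIME(n) ⊆ UTIME(n^c) → NP ⊆ UP, provable) → DownwardU (NP = UP → NTIME(n) ⊆
UTIME(n), the open content) →
LadderClimbU.

KILL CRITERIA. A proof of NTIME(n) ⊆ UTIME(n) (multi-stack) refutes NlinNotInUlin and closes the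
route `refuted:NlinNotInUlin` (and is a theorem worth
more than the route). Collision ∈ UTIME(n) kills door L1's witness only — pivot to door L2 or to a
block-respecting witness. A proof that
NLIN ⊄ ULIN is compatible with NLIN ⊆ UTIME(n²) in some relativized or generic sense does not refute
LadderClimbU but marks it unattackable
— keep it residual. TRIBUNAL EXPOSURE, stated up front: LadderClimbU (and, tautologically, any
calibration binder) is dominated by the top
NP ≠ UP; if the tribunal rules it summit-strength under T1 rule (a) as it did for the sibling's
climb (route-PneNP-NtimeComplementLadder,
retired 2026-08-17, kernel t1c via registered NPNeCoNP), the named re-target is NlinNotInUlin as a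
FRONTIER ladder rung under top NP ≠ UP,
with the typed witness, skeletons and the ported single-tape rung standing. NP ≠ UP proved elsewhere
moots LadderClimbU and the route's
summit claim (S would follow from it directly); NP = UP proved elsewhere refutes ULadder and retires
the route while leaving NlinNotInUlin open.

Ladder census (not a catalogued barrier decl, cited by file):
`Literature/Barriers/PneNP/Ladder.lean` §2H R-I1 names this family (census 136, NTIME vs UTIME) with
ceiling A1 and "nothing climbs from a fixed c to all c (that climb IS the top)" — conceded verbatim:
that is why LadderClimbU is declared residual and the route is filed for the FRONTIER ledger.

NOT DECOMPOSED YET. The time–space truncations NTIME(n) ⊄ UTISP(n^a, n^b) (need NTISP/UTISP over TM2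
— definition request), the counting-mode forms, the
tape+stream rung and the Maass-model residue of the 2001 programme (layer-2 children of
NlinNotInUlin, later); the uniform Cook–Levin
exponent and the UTIME pull-back lemma (children of UCalibration, provable); the NE ≠ UE tally face
(aside, not filed).

CHEAPEST FALSIFIER. Lookup, run this session: is "NTIME(n) ⊆ UTIME(n) ⇒ NP = UP" or any
NTIME-vs-UTIME statement at linear time in print? Corpus fts+vec
("UP unambiguous polynomial time padding tally NE UE", "unambiguous linear time hierarchy", vsearch
prose) and the sketch's galaxy needles
("NTIME(n) = UTIME", "UTIME(n)", "unambiguous time classes") — no hit beyond HemaspaandraRothe1997's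
open-question list and advice
hierarchies (U vs U). Next cheapest (a refuter, one afternoon): exhibit an unambiguous linear-time
multi-stack certificate for Collision
(kills door L1); or `lean check` the folder rung `bc/NlinNotInUlin_rung.lean` (done: rc 0, 0
sorries).

NUMBERS. Single-tape: 1-NTIME(n·a(n)) ⊄ 1-UTIME(o(n²/a(n)))-type trade-off with the exact ambiguity
parameter (2001 programme, ported rung a = 1:
`NtuLower.unambiguous_lower_bound`); Wiedermann 1996 (book:editor1996-automata-languages-programming
p.422–433, Thms 4.3–4.4): single-tape
NTIME₁(T) ⊆ Σ₂-TIME₁(T/log T) and NTIME₁(T) ≠ co-NTIME₁(T) for T ≥ n²; Loryś 1992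
(book:editor1992-stacs-92 p.357–358): the crossing-
sequence method's printed ceiling "tight hierarchy below n² only". Multitape: NTIME(n) ≠ DTIME(n)
(PaulEtAl1983; Santhanam2001 √log* gap);
nothing for U. Items at open: 5 (2 cruxes, 1 target, 1 support, 1 assembly).

DEFINITION REQUESTS. After open: (D1) `NTISP` / `UTISP` (simultaneous time–space verifier classes
over TM2; topic Literature/Computability/Complexity) for the
truncation rungs; (D2) `Collision` / `Ldist` as shared Literature languages
(BookGreibachWegbreit1970's L_dist and its complement; currently
typed in the seat folder with `decodeBlocks`); (F1) cite fact "uniform Cook–Levin exponent for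
NTIME(n)" (AroraBarakCC2009 Thm 2.10 with the
O(T log T) tableau) for UCalibration.

Novelty: Searches (2026-08-16/17, both corpora, labels per BC8): corpus `lit search --hybrid "unambiguous
Turing machine time lower bound crossing
sequence partition number"` (8 docs;
[corpus:book:liskiewicz2005-fundamentals-computation-theory-15th-international-symposium-fct
p.146–149]
Spakowski–Tripathi relativized unambiguity hierarchies, barrier side;
[corpus:book:homer2011-computability-complexity-theory p.78,84,100,192] UP
background, 0 lines on UTIME/padding); `lit search "UP unambiguous polynomial time padding tally NE
UE Hartmanis Immerman Sewelson sparse"` and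
`lit vsearch` prose of the U-padding statement → no U-padding / NTIME-vs-UTIME hit; `lit search
--hybrid "single-tape nondeterministic time
hierarchy crossing sequence complement"` → [corpus:book:editor1996-automata-languages-programming
p.422–433] Wiedermann ICALP 1996,
[corpus:book:editor1992-stacs-92 p.357–358] Loryś STACS 1992,
[corpus:book:lin2022-reachability-problems p.114–120] Yamakami RP 2022
(unambiguity/fewness separations for nonuniform finite-automata families — finite-model rung);
galaxy (sketch session, verbatim needles
"unambiguous Turing machine|NP = UP", "NTIME(n) = UTIME|UTIME(n)|unambiguous time classes") →
[galaxy:pdf:421838160] Rothe ECCC 2001-096,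
[galaxy:pdf:-1419476208388360480] Hemaspaandra–Ogihara, [galaxy:pdf:8862589252998412440]
Dhayal–Impagliazzo TR19-167, [galaxy:pdf:2055507540]
Allender columns — none on NTIME vs UTIME; this session's galaxy re-runs queued > 90 s twice
(saturated, noted)  [refs: 10.1137/S0097539794261970, book:liskiewicz2005-fundamentals-computation-theory-15th-international-symposium-fct, book:homer2011-computability-complexity-theory, book:editor1996-automata-languages-programming, book:editor1992-stacs-92, book:lin2022-reachability-problems, doi:10.1137/S0097539794261970, HemaspaandraRothe1997, PaulEtAl1983, Yannakakis1991, Jukna2012]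

Barriers (technique_class: crossing-sequence, simulation, diagonalization, padding): - technique_class: crossing-sequence, simulation, diagonalization, padding
- Literature.Barriers.PneNP.Relativization: per crux — [NlinNotInUlin] OUTSIDE the technique class:
as typed it admits no relativizing proof (linear-time oracles make NTIME/UTIME collapse or separate
either way), and the route's lever is the catalogue's own named escape, tape-structure /
crossing-sequence arguments that inspect tape contents an oracle step can bypass (every proved rung
— single-tape, sublinear-space — is of this kind; cf. `TIME(n) ≠ NTIME(n)` among the
non-relativizing results quoted in the barrier's scope caveats); [UCalibration] a provable padding +
Cook–Levin calibration (relativizing, harmless: a theorem-to-be, not a separation); [LadderClimbU]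
INSIDE the class with no escape claimed — the DECLARED RESIDUAL, carried unproved and not attacked
(padding relativizes; the climb is the top NP ≠ UP in disguise).
- Literature.Barriers.PneNP.BoundedRelativization: same per-crux placement as Relativization (no
bounded-query or PSPACE-oracle robustness is claimed anywhere; the rung proofs read tape contents).
- Literature.Barriers.PneNP.RelativizationNarrow: same per-crux placement as Relativization, in the
narrowed entry's own sense (robustness under EVERY language oracle in the full-access `PRel`/`NPRel`
model): the attacked crux NlinNotInUlin claims no oracle-independence — crossing-sequence /
tape-structure rung proofs fail relative to oracles — and uses no sparse/tally oracle statement (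

History (route lifecycle, newest last):
- 2026-08-27T13:18:00Z · CLOSED closed — tribunal-failed:summit-strength (operator:999:1000014)

sub-problem: PneNP · status: closed(closed) · opened planner-type-15711cab16-0 2026-08-17T18:57:16Z · rev 2 · ledger route-PneNP-NtimeNotUnambiguousLadder
GENERATED by the gate from the ledger (D-0016/17). Provers cite these decls: `theorem foo : Summit.PneNP.PneNP.Theses.NtimeNotUnambiguousLadder.<Decl> := …` in Summits/PneNP/PneNP/Theorems/<Name>.lean.
-/

namespace Summit.PneNP.PneNP.Theses.NtimeNotUnambiguousLadder

open scoped BigOperators Topology Manifold Classical MeasureTheory ProbabilityTheory Matrix InnerProductSpace ComplexConjugate ContinuousMap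
open Filter Set Function TopologicalSpace MeasureTheory

attribute [summit_statement] _root_.PneNP

open Literature.PNP

/-- item stmt-PneNP-19826 · crux · rank 2 · closed · moot by None · by planner
why it might fail: multi-stack NLIN ⊆ ULIN contradicts nothing known: every proved U ≠ N time separation is single-tape, finite-automaton or protocol-level, or needs advice; an isolation-style unambiguous simulation at linear cost (cf. NL ⊆ UL/poly) would refute it.
sources: HemaspaandraRothe1997, PaulEtAl1983, BookGreibachWegbreit1970, book:editor1996-automata-languages-programming, Yannakakis1991
[crux] nondeterministic linear time (TM2 verifiers with linear clock and linear witness) is not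
contained in unambiguous linear time: ¬ (NTIME(n) ⊆ UTIME(n)). Sketch item X1; doors L1 (Collision ∉
UTIME(n), birth skeleton) and L2 (U-complementation + the sibling's coNTIME(n) ⊄ NTIME(n)).
[difficulty: open-problem] -/
@[route_item "route-PneNP-NtimeNotUnambiguousLadder", crux]
def NlinNotInUlin : Prop :=
  ¬ (Literature.Computability.Complexity.NTIME (fun n : ℕ => n) ⊆ Literature.Computability.Complexity.UTIME (fun n : ℕ => n))

/-- item stmt-PneNP-19827 · crux · rank 3 · closed · moot by None · by planner
why it might fail: false iff NLIN ⊄ ULIN yet NLIN ⊆ UTIME(n^c) for some c ≥ 2 — a priori consistent (no downward translation NP = UP ⇒ NLIN ⊆ ULIN is known; HIS85-type translations go upward only, and relativized worlds separate the two levels).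
sources: Book1974, HartmanisImmermanSewelson1985, HemaspaandraRothe1997
[crux] DECLARED RESIDUAL — rung 1 climbs the ladder: NTIME(n) ⊄ UTIME(n) → ∀ c ≥ 1, NTIME(n) ⊄
UTIME(n^c). Equivalent, given rung 1, to NP ≠ UP; implied by the downward translation "NP = UP ⇒
NTIME(n) ⊆ UTIME(n)"; dominated by the (unregistered) top NP ≠ UP through unambiguous upward padding
(folklore, unprinted as far as searched). Not attacked; carried so that `closes` is honest about
what separates rung 1 from P ≠ NP. [deps: NlinNotInUlin] [difficulty: open-problem] -/
@[route_item "route-PneNP-NtimeNotUnambiguousLadder", crux]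
def LadderClimbU : Prop :=
  ¬ (Literature.Computability.Complexity.NTIME (fun n : ℕ => n) ⊆ Literature.Computability.Complexity.UTIME (fun n : ℕ => n)) → ∀ c : ℕ, 1 ≤ c → ¬ (Literature.Computability.Complexity.NTIME (fun n : ℕ => n) ⊆ Literature.Computability.Complexity.UTIME (fun n : ℕ => n ^ c))

/-- item stmt-PneNP-19825 · aside · rank 0 · closed · moot by None · by planner
why it might fail: equivalent (padding up, uniform Cook–Levin down) to NP ≠ UP, a super-summit top: refuted by any collapse NTIME(n) ⊆ UTIME(n^c), e.g. from an isolation lemma derandomised at polynomial cost.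
sources: Valiant1976, HemaspaandraRothe1997, Book1974
[target] the unambiguous ladder — for every c ≥ 1, NTIME(n) ⊄ UTIME(n^c) (multi-stack TM2 verifier
classes); rung 1 is NlinNotInUlin up to `pow_one`. -/
@[route_item "route-PneNP-NtimeNotUnambiguousLadder"]
def ULadder : Prop :=
  ∀ c : ℕ, 1 ≤ c → ¬ (Literature.Computability.Complexity.NTIME (fun n : ℕ => n) ⊆ Literature.Computability.Complexity.UTIME (fun n : ℕ => n ^ c))

/-- item stmt-PneNP-19828 · support · rank 9 · closed · moot by None · by planner
sources: AroraBarakCC2009, Cook1971, Valiant1976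
[support] calibration, provable (L): the ladder denies SAT an unambiguous verifier of every
polynomial budget — ULadder → ∀ k, SAT ∉ UTIME(n^k). Proof plan: SAT ∈ UTIME(n^k) + a UNIFORM
Cook–Levin exponent a for NTIME(n) (every L ∈ NTIME(n) Karp-reduces to SAT in deterministic time
O(n^a), tree `CookLevinTableau`) + pull-back closure of UTIME under such reductions ⇒ NTIME(n) ⊆
UTIME(n^{ak+a}), contradicting the rung c = ak + a. [difficulty: L] -/
@[route_item "route-PneNP-NtimeNotUnambiguousLadder", crux]
def UCalibration : Prop :=
  (∀ c : ℕ, 1 ≤ c → ¬ (Literature.Computability.Complexity.NTIME (fun n : ℕ => n) ⊆ Literature.Computability.Complexity.UTIME (fun n : ℕ => n ^ c))) → ∀ k : ℕ, Literature.Computability.Complexity.SAT ∉ Literature.Computability.Complexity.UTIME (fun n : ℕ => n ^ k)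

/-- item stmt-PneNP-20373 · support · rank 9 · closed · moot by None · by planner
[support] NAMED OPEN CONJECTURE `NP ≠ UP` (Valiant 1976; Hemaspaandra–Rothe 1997 §1, arXiv
cs/9907033 p.2) — the TOP of this route's ladder: ULadder (∀ c ≥ 1, NTIME(n) ⊄ UTIME(n^c)) ⟺ NP ≠ UP
(up: padding, soloInformed_exists_mem_NTIME_pow_pos_of_mem_NP + padLin_mem_NTIME_id +
UTIME_pow_subset_UP + preimage_mem_UP (p532397); down: UP_eq_iUnion_UTIME + SAT_mem_NP_holds +
P_subset_UP), see item UTopCalibration. Registered (tribunal T1 ca3c09d9c56a312d / J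
fe4be13e14828db8 suggestion) so that LadderClimbU is visible as this conjecture in costume and
future U-climbs dedup against it; HORIZON — never staff a prover on it (NPNeUP → PneNP via
P_subset_UP). Registry copy @[strong_hypothesis] + bridge npNeUP_implies_PneNP filed as operator
TURNKEY (Summits/PneNP/StrongHypotheses.lean draft, scratch rc 0). -/
@[route_item "route-PneNP-NtimeNotUnambiguousLadder"]
def NPNeUP : Prop :=
  Literature.Computability.Complexity.Nondeterministic.NP ≠ Literature.Computability.Complexity.UP

/-- item stmt-PneNP-19829 · assembly · rank 1 · closed · moot by None · by planner
sources: Valiant1976, CookClay2006, AroraBarakCC2009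
[assembly] NlinNotInUlin → LadderClimbU → UCalibration → PneNP (the deciding theorem `closes` proves
exactly this and applies it). -/
@[route_item "route-PneNP-NtimeNotUnambiguousLadder"]
def Assembly : Prop :=
  NlinNotInUlin → LadderClimbU → UCalibration → PneNP

/-! D-0027 §2.1 — DECIDING THEOREM (planner-authored via `route open/edit --closes-file`; by planner-type-15711cab16-0 2026-08-17T18:59:15Z) — ARCHIVED: route closed (closed) 2026-08-27T13:17:55Z; kept so importers keep building:
its hypotheses are this route's items and its conclusion the sub-problem Statement (glue_lint), and it elaborates with this file. -/

/-- D-0027 §2.1 deciding theorem: rung 1 (attacked), the residual climb and the calibration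
support give `SAT ∉ UTIME(nᵏ)` for every `k`, i.e. `SAT ∉ UP` (`UP_eq_iUnion_UTIME`); since
`P ⊆ UP` (`P_subset_UP`) and `SAT ∈ NP` (`SAT_mem_NP_holds`), `P = NP` is impossible, i.e.
Cook's shape `PneNP` (`pneNP_shape_of_P_ne_NP`). This is literally the `Assembly` item, proved. -/
@[closes "route-PneNP-NtimeNotUnambiguousLadder"] theorem closes (h₁ : NlinNotInUlin) (h₂ : LadderClimbU) (h₃ : UCalibration) : PneNP := by
  have hA : Assembly := by
    intro h₁ h₂ h₃
    have hL : ULadder := h₂ h₁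
    have hS : ∀ k : ℕ, Literature.Computability.Complexity.SAT ∉
        Literature.Computability.Complexity.UTIME (fun n : ℕ => n ^ k) := h₃ hL
    refine Literature.Computability.Complexity.pneNP_shape_of_P_ne_NP ?_
    intro hPNP
    have hSP : Literature.Computability.Complexity.SAT ∈
        Literature.Computability.Complexity.Classes.P := by
      rw [hPNP]; exact Literature.Computability.Complexity.SAT_mem_NP_holds
    have hSU : Literature.Computability.Complexity.SAT ∈ Literature.Computability.Complexity.UP :=
      Literature.Computability.QuantumComplexity.P_subset_UP hSP
    rw [Literature.Computability.Complexity.UP_eq_iUnion_UTIME, Set.mem_iUnion] at hSU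
    obtain ⟨k, hk⟩ := hSU
    exact hS k hk
  exact hA h₁ h₂ h₃

end Summit.PneNP.PneNP.Theses.NtimeNotUnambiguousLadder
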